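import Literature.NumberTheory.Automorphic.UnboundedDenominatorsDegreeProofs
import HarnessLib

/-!
# The unbounded denominators theorem (Calegari–Dimitrov–Tang) — §6.3: the assembly of Theorem 1.0.1 from its inputs

PROOF-ONLY capstone (no definition, no named fact; D-0026) of the fields instalment of the
formalization of F. Calegari, V. Dimitrov, Y. Tang, *The unbounded denominators conjecture*, J. Amer.
Math. Soc. **38** (2025), 627–702 = arXiv:2109.09040 (`UnboundedDenominatorsFields.lean`,
`…FieldsProofs.lean`, `…DilationProofs.lean`, `…LevelFieldProofs.lean`, `…DegreeProofs.lean`), and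
of the skeletons `CalegariDimitrovTang2025_unboundedDenominators.le_one_of_log_bound_of_doubling`
(Proposition 4.3.5 / arXiv v1 Proposition 26, `UnboundedDenominatorsProofs.lean`) and
`CalegariDimitrovTang2025_unboundedDenominators.of_bddDenField_le_levelField` (§6.3).

CDT §6.3 ("Proof of Theorem 1.0.1"): "By Proposition 3.0.1 [the dimension bound
`[R_N : M_2] ≤ C N³ log N`] … Proposition 4.3.5 [the leveraging: Theorem 4.3.2 + (4.3.3)] … we obtain
`R_N = M_N` for every `N`, that is, the unbounded denominators conjecture holds."

## What is proved

★ `CalegariDimitrovTang2025_unboundedDenominators.of_inputs` — **the named fact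
`CalegariDimitrovTang2025_unboundedDenominators` follows from the following inputs, and nothing else**
(all in hypothesis form, deliberately NOT named facts — D-0026):

1. `hker₂` — for every `N` and every prime `p ∤ N`, with `A = diag(p, 1)`: the amalgam + congruence
   subgroup property sentence for `SL₂(ℤ[1/p])` (CDT Lemma 4.4.1 / 4.6.2; classical: Serre, Mennicke);
2. `hcor` — for every `N`: CDT Corollary 4.5.3 (of the cohomological Theorem 4.5.2);
3. `hrat` — for every `N`: the rationality of `M_{12m}(Γ(N))` (Shimura 1971, Theorem 3.52): every
   `F/Δᵐ`, `F ∈ M_{12m}(Γ(N))`, lies in `levelField N`;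
4. `hfg`, `hfinite` — finite generation of `R_N` and finiteness of `[R_{N'} : M_N]` for `N ∣ N'`
   (CDT: everything is finite over `M_2 = ℚ(λ)` by the holonomy bound, Lemma 4.2.3);
5. `hbound` — the logarithmic gap `[R_N : M_N] ≤ C log N` for even `N` (CDT display (4.3.4): the
   dimension bound of Proposition 3.0.1, `[R_N : M_2] ≤ C N³ log N` — holonomy bound + conformal
   radius (Theorem 5.1.4) + mean growth (Theorem 6.0.1) — divided by (4.3.3)
   `[M_N : M_2] = ½[Γ(2) : Γ(N)] > N³/12ζ(2)`).

Proof: for even `N`, Theorem 4.3.2 (`two_mul_relfinrank_le`) is the doubling hypothesis and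
`hbound` the bound of the leveraging skeleton `…le_one_of_log_bound_of_doubling` on the set of even
positive integers (stable under `N ↦ N p`, `p ∤ N`); so `[R_N : M_N] ≤ 1`, i.e. `R_N = M_N` for even
`N` (`bddDenField_eq_levelField_of_inputs`), which is the hypothesis of
`…of_bddDenField_le_levelField`. Inputs 1–2 are the business of the group-theory files
(`…IharaEnhancedProofs.lean` reduces Theorem 4.3.1 to them), 3 is a classical named-fact candidate,
4–5 are the analytic side (`…DimensionBoundProofs.lean`: Proposition 3.0.1 modulo the radius bound and
the algebraization).

## References

* [CalegariDimitrovTang2025] F. Calegari, V. Dimitrov, Y. Tang, The unbounded denominators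
  conjecture, J. Amer. Math. Soc. 38 (2025), no. 3, 627–702; arXiv:2109.09040. §4.3
  (Theorem 4.3.2, (4.3.3)–(4.3.4), Proposition 4.3.5), §6.3.
-/

noncomputable section

namespace Literature.NumberTheory.Automorphic

open scoped MatrixGroups ModularForm Manifold
open UpperHalfPlane CongruenceSubgroup Matrix.SpecialLinearGroup ModularGroup

namespace UnboundedDenominators

/-- An element of `GL₂(ℝ)` with matrix `diag(p, 1)`, for `p ≠ 0`. [folklore] -/
private theorem exists_GL_diag {p : ℕ} (hp : p ≠ 0) :
    ∃ A : GL (Fin 2) ℝ, (A : Matrix (Fin 2) (Fin 2) ℝ) = !![(p : ℝ), 0; 0, 1] :=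
  ⟨Matrix.GeneralLinearGroup.mkOfDetNeZero !![(p : ℝ), 0; 0, 1]
    (by rw [Matrix.det_fin_two_of]; simp [hp]), rfl⟩

/-- ★ **`R_N = M_N` for every even `N`, from the inputs of CDT's proof**
[cite: CalegariDimitrovTang2025, Proposition 4.3.5 and §6.3]: granted `hker₂`, `hcor` (the inputs of
Theorem 4.3.1), `hrat` (rationality of `M_{12m}(Γ(N))`), finite generation / finiteness, and the
logarithmic gap `hbound : [R_N : M_N] ≤ C log N` for even `N`, one has
`bddDenField N = levelField N` for every even `N > 0`. (Leveraging: Theorem 4.3.2 doubles the degree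
under `N ↦ N p`, Bertrand primes make it outgrow `C log N`.) -/
theorem bddDenField_eq_levelField_of_inputs
    (hker₂ : ∀ (N p : ℕ) (A : GL (Fin 2) ℝ), (A : Matrix (Fin 2) (Fin 2) ℝ) = !![(p : ℝ), 0; 0, 1] →
      p.Prime → ¬ p ∣ N →
      ∀ (Δ : Type) [Group Δ] [Finite Δ] (g₁ g₂ : Gamma N →* Δ),
      (∀ (x : SL(2, ℤ)) (hx : x ∈ Gamma N), x ∈ Gamma0 p → ∀ (y : SL(2, ℤ)) (hy : y ∈ Gamma N),
        A * mapGL ℝ x = mapGL ℝ y * A → g₁ ⟨x, hx⟩ = g₂ ⟨y, hy⟩) →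
      (∃ M : ℕ, M ≠ 0 ∧ ∀ (x : SL(2, ℤ)) (hx : x ∈ Gamma N), x ∈ Gamma M → g₁ ⟨x, hx⟩ = 1) ∧
      (∃ M : ℕ, M ≠ 0 ∧ ∀ (x : SL(2, ℤ)) (hx : x ∈ Gamma N), x ∈ Gamma M → g₂ ⟨x, hx⟩ = 1))
    (hcor : ∀ (N : ℕ) (Q : Type) [CommGroup Q] [Finite Q] (θ : Gamma N →* Q),
      (∀ g : SL(2, ℤ), ∃ M : ℕ, M ≠ 0 ∧ ∀ (x : SL(2, ℤ)) (hx : x ∈ Gamma N)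
        (hgx : g * x * g⁻¹ ∈ Gamma N), x ∈ Gamma M → θ ⟨g * x * g⁻¹, hgx⟩ = θ ⟨x, hx⟩) →
      ∃ M : ℕ, M ≠ 0 ∧ ∀ (x : SL(2, ℤ)) (hx : x ∈ Gamma N), x ∈ Gamma M → θ ⟨x, hx⟩ = 1)
    (hrat : ∀ (N m : ℕ) (F : ModularForm ((Gamma N : Subgroup SL(2, ℤ)) : Subgroup (GL (Fin 2) ℝ))
      (12 * (m : ℤ))), algebraMap hol Mer (modFun m F) ∈ levelField N)
    (hfg : ∀ N : ℕ, 0 < N → (bddDenField N).FG)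
    (hfinite : ∀ N N' : ℕ, 0 < N → N ∣ N' →
      0 < IntermediateField.relfinrank (levelField N) (bddDenField N'))
    (hbound : ∃ C : ℝ, ∀ N : ℕ, 0 < N → Even N →
      (IntermediateField.relfinrank (levelField N) (bddDenField N) : ℝ) ≤ C * Real.log N)
    {N : ℕ} (hN : 0 < N) (heven : Even N) : bddDenField N = levelField N := by
  obtain ⟨C, hC⟩ := hbound
  -- the leveraging skeleton on the set of even positive integers
  let S : Set ℕ := {N | 0 < N ∧ Even N}
  have hS : ∀ N ∈ S, ∀ p : ℕ, p.Prime → ¬ p ∣ N → N * p ∈ S := fun N hNS p hp _ ↦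
    ⟨Nat.mul_pos hNS.1 hp.pos, hNS.2.mul_right p⟩
  let r : ℕ → ℕ := fun N ↦ IntermediateField.relfinrank (levelField N) (bddDenField N)
  have hdouble : ∀ N ∈ S, ∀ p : ℕ, p.Prime → ¬ p ∣ N → 1 < r N → 2 * r N ≤ r (N * p) := by
    intro N hNS p hp hpN h1
    obtain ⟨A, hA⟩ := exists_GL_diag hp.ne_zero
    have hNp : N.Coprime p := (Nat.Prime.coprime_iff_not_dvd hp).mpr hpN |>.symm
    have hne : bddDenField N ≠ levelField N := by
      intro heq
      have : r N = 1 := by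
        change IntermediateField.relfinrank (levelField N) (bddDenField N) = 1
        rw [heq, IntermediateField.relfinrank_self]
      omega
    exact two_mul_relfinrank_le hNS.1.ne' hp hNp hA (hker₂ N p A hA hp hpN) (hcor N) (hrat N)
      (hrat (N * p)) (hfg N hNS.1) (hfinite N (N * p) hNS.1 (dvd_mul_right N p)) hne
  have hle : r N ≤ 1 :=
    CalegariDimitrovTang2025_unboundedDenominators.le_one_of_log_bound_of_doubling hS r C
      (fun N hNS ↦ hC N hNS.1 hNS.2) hdouble N ⟨hN, heven⟩ hN.ne'
  have hpos : 0 < r N := by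
    have := hfinite N N hN dvd_rfl
    exact this
  have h1 : IntermediateField.relfinrank (levelField N) (bddDenField N) = 1 := by
    change r N = 1
    omega
  exact le_antisymm (IntermediateField.relfinrank_eq_one_iff.mp h1) (levelField_le_bddDenField N)

/-- ★★ **CDT Theorem 1.0.1 from its inputs** [cite: CalegariDimitrovTang2025, §6.3 ("Proof of
Theorem 1.0.1")]: the named fact `CalegariDimitrovTang2025_unboundedDenominators` follows from
(1) the amalgam/CSP sentence `hker₂` for every level `N` and prime `p ∤ N`, (2) Corollary 4.5.3
`hcor` for every `N`, (3) the rationality of `M_{12m}(Γ(N))` for every `N` (Shimura 3.52),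
(4) finite generation of `R_N` and finiteness of `[R_{N'} : M_N]`, (5) the logarithmic gap
`[R_N : M_N] ≤ C log N` for even `N` (Proposition 3.0.1 with (4.3.3)) — via
`bddDenField_eq_levelField_of_inputs` (`R_N = M_N` for even `N`) and
`CalegariDimitrovTang2025_unboundedDenominators.of_bddDenField_le_levelField`. This is the §6.3
assembly of the published proof with §§4.2–4.3 PROVED; the five inputs are exactly what remains. -/
theorem _root_.Literature.NumberTheory.Automorphic.CalegariDimitrovTang2025_unboundedDenominators.of_inputs
    (hker₂ : ∀ (N p : ℕ) (A : GL (Fin 2) ℝ), (A : Matrix (Fin 2) (Fin 2) ℝ) = !![(p : ℝ), 0; 0, 1] →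
      p.Prime → ¬ p ∣ N →
      ∀ (Δ : Type) [Group Δ] [Finite Δ] (g₁ g₂ : Gamma N →* Δ),
      (∀ (x : SL(2, ℤ)) (hx : x ∈ Gamma N), x ∈ Gamma0 p → ∀ (y : SL(2, ℤ)) (hy : y ∈ Gamma N),
        A * mapGL ℝ x = mapGL ℝ y * A → g₁ ⟨x, hx⟩ = g₂ ⟨y, hy⟩) →
      (∃ M : ℕ, M ≠ 0 ∧ ∀ (x : SL(2, ℤ)) (hx : x ∈ Gamma N), x ∈ Gamma M → g₁ ⟨x, hx⟩ = 1) ∧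
      (∃ M : ℕ, M ≠ 0 ∧ ∀ (x : SL(2, ℤ)) (hx : x ∈ Gamma N), x ∈ Gamma M → g₂ ⟨x, hx⟩ = 1))
    (hcor : ∀ (N : ℕ) (Q : Type) [CommGroup Q] [Finite Q] (θ : Gamma N →* Q),
      (∀ g : SL(2, ℤ), ∃ M : ℕ, M ≠ 0 ∧ ∀ (x : SL(2, ℤ)) (hx : x ∈ Gamma N)
        (hgx : g * x * g⁻¹ ∈ Gamma N), x ∈ Gamma M → θ ⟨g * x * g⁻¹, hgx⟩ = θ ⟨x, hx⟩) →
      ∃ M : ℕ, M ≠ 0 ∧ ∀ (x : SL(2, ℤ)) (hx : x ∈ Gamma N), x ∈ Gamma M → θ ⟨x, hx⟩ = 1)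
    (hrat : ∀ (N m : ℕ) (F : ModularForm ((Gamma N : Subgroup SL(2, ℤ)) : Subgroup (GL (Fin 2) ℝ))
      (12 * (m : ℤ))), algebraMap hol Mer (modFun m F) ∈ levelField N)
    (hfg : ∀ N : ℕ, 0 < N → (bddDenField N).FG)
    (hfinite : ∀ N N' : ℕ, 0 < N → N ∣ N' →
      0 < IntermediateField.relfinrank (levelField N) (bddDenField N'))
    (hbound : ∃ C : ℝ, ∀ N : ℕ, 0 < N → Even N →
      (IntermediateField.relfinrank (levelField N) (bddDenField N) : ℝ) ≤ C * Real.log N) :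
    CalegariDimitrovTang2025_unboundedDenominators :=
  CalegariDimitrovTang2025_unboundedDenominators.of_bddDenField_le_levelField fun _ hN heven ↦
    (bddDenField_eq_levelField_of_inputs hker₂ hcor hrat hfg hfinite hbound hN heven).le

end UnboundedDenominators

end Literature.NumberTheory.Automorphic

end
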